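import Literature.IUT.HodgeTheaters.ProfiniteCompletionQuotients
import HarnessLib

/-!
# `End(ℤ̂)` is commutative: every group endomorphism of `ℤ̂` is multiplication by a profinite integer

[IUTchI] §2 Lemma 2.7 (v) p. 57 ("the surjection `Ĝ ↠ ℤ̂`", `T̂ ≅ ℤ̂`) and the [IUTchII] §1 interfaces that act on rank-one
cyclotomes "via the natural action of `Ẑ^×`" ([IUTchII] Rmk. 1.11.1 (i)(b) p. 50; Cor. 1.11 (a)(b) p. 49: orbits under
closed subgroups `Γ ⊆ Ẑ^×` and under `Aut(G)`) use the classical RIGIDITY of `Ẑ` AS AN ABSTRACT GROUP: for the tree's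
`ZHat = profiniteCompletion (Multiplicative ℤ)` (Mathlib's `ProfiniteGrp.ProfiniteCompletion.completion`),
* `exists_pow_index_eq_of_val_eq_one` — `Ker(Ẑ → ℤ/N)` consists of `[ℤ:N]`-th powers (`Ẑ/NẐ = ℤ/NẐ`: an element with
  trivial `N`-component is divisible by `[ℤ:N]` in `Ẑ`; the quotient `y` is built componentwise from the components of
  `x` at the subgroups of index `[ℤ:N]·[ℤ:M]`);
* `monoidHom_val_eq` — hence EVERY (not necessarily continuous) group endomorphism `φ` of `Ẑ` acts on each finite
  level `ℤ/N` as multiplication by an integer (a representative of the `N`-component of `φ(1)`);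
* `monoidHom_comp_comm` — so `End(Ẑ)` is commutative, and (`monoidHom_apply_comm_of_mulEquiv`,
  `mulEquiv_apply_comm_of_mulEquiv`) so is the endomorphism monoid / automorphism group of ANY group `≃* Ẑ`
  (e.g. the cyclotomes `(l·Δ_Θ)`, `μ_Ẑ(G)` of [IUTchII] §1 once identified with `Ẑ`).
Auxiliary: subgroups of `ℤ` are classified by their index (`ofAdd_mem_iff_index_dvd`, `le_iff_index_dvd`,
`exists_index_eq`, `index_eq_orderOf`); v2 (append-only) adds `monoidHom_eq_of_apply_one_eq` (an endomorphism is
determined by its value at `1`), `scalar_indep` (the scalar `e (α (e⁻¹ 1)) ∈ Ẑ` of an endomorphism `α` of a group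
`M ≃* Ẑ` does not depend on `e`) and `semiconj_iff_scalar_eq` (an isomorphism intertwines two endomorphisms iff their
scalars agree). Classical; proof-only (no definitions), recorded once for the consumers
(abc-iut cell, layer L6, seat abc-iut-w5-d145; first consumer: the B12 `Π`-side scalar reduction
`IUT/HodgeArakelov/GaloisPairCyclotomesThetaSyncScalar.lean`). [cite: Mochizuki2012, I Lem 2.7 (v) p.57]
-/

namespace Literature.IUT.HodgeTheaters

open ProfiniteGrp ProfiniteGrp.ProfiniteCompletion

namespace ZHat

/-- Every component of an element of `Ẑ` has an integer representative.
[cite: Mochizuki2012, I Lem 2.7 (v) p.57] -/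
theorem exists_val_eq_mk (x : ZHat) (N : FiniteIndexNormalSubgroup (Multiplicative ℤ)) :
    ∃ a : ℤ, x.val N = (QuotientGroup.mk (Multiplicative.ofAdd a) : Multiplicative ℤ ⧸ N.toSubgroup) := by
  obtain ⟨g, hg⟩ := QuotientGroup.mk_surjective (x.val N)
  exact ⟨Multiplicative.toAdd g, by rw [ofAdd_toAdd]; exact hg.symm⟩

/-- In `ℤ ⧸ H`, the class of `a` is the `a`-th power of the class of `1`.
[cite: Mochizuki2012, I Lem 2.7 (v) p.57] -/
theorem mk_ofAdd_eq_zpow (H : Subgroup (Multiplicative ℤ)) (a : ℤ) :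
    (QuotientGroup.mk (Multiplicative.ofAdd a) : Multiplicative ℤ ⧸ H) =
      (QuotientGroup.mk (Multiplicative.ofAdd (1 : ℤ)) : Multiplicative ℤ ⧸ H) ^ a := by
  rw [← QuotientGroup.mk_zpow, ← ofAdd_zsmul, smul_eq_mul, mul_one]

/-- The class of `1` generates `ℤ ⧸ H`.
[cite: Mochizuki2012, I Lem 2.7 (v) p.57] -/
theorem zpowers_mk_ofAdd_one (H : Subgroup (Multiplicative ℤ)) :
    Subgroup.zpowers (QuotientGroup.mk (Multiplicative.ofAdd (1 : ℤ)) : Multiplicative ℤ ⧸ H) = ⊤ := by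
  rw [eq_top_iff]
  rintro q -
  obtain ⟨g, rfl⟩ := QuotientGroup.mk_surjective q
  refine ⟨Multiplicative.toAdd g, ?_⟩
  change (QuotientGroup.mk (Multiplicative.ofAdd (1 : ℤ)) : Multiplicative ℤ ⧸ H) ^ (Multiplicative.toAdd g) = _
  rw [← mk_ofAdd_eq_zpow, ofAdd_toAdd]

/-- The index of a subgroup `H` of `ℤ` is the order of the class of `1` in `ℤ ⧸ H`.
[cite: Mochizuki2012, I Lem 2.7 (v) p.57] -/
theorem index_eq_orderOf (H : Subgroup (Multiplicative ℤ)) :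
    H.index = orderOf (QuotientGroup.mk (Multiplicative.ofAdd (1 : ℤ)) : Multiplicative ℤ ⧸ H) := by
  rw [← Nat.card_zpowers, zpowers_mk_ofAdd_one, Subgroup.card_top]
  rfl

/-- Membership in a subgroup of `ℤ` is divisibility by its index.
[cite: Mochizuki2012, I Lem 2.7 (v) p.57] -/
theorem ofAdd_mem_iff_index_dvd (H : Subgroup (Multiplicative ℤ)) (a : ℤ) :
    Multiplicative.ofAdd a ∈ H ↔ (H.index : ℤ) ∣ a := by
  rw [← QuotientGroup.eq_one_iff, mk_ofAdd_eq_zpow, ← orderOf_dvd_iff_zpow_eq_one, ← index_eq_orderOf]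

/-- Subgroups of `ℤ` are ordered by divisibility of their indices (finite index).
[cite: Mochizuki2012, I Lem 2.7 (v) p.57] -/
theorem le_iff_index_dvd (K L : FiniteIndexNormalSubgroup (Multiplicative ℤ)) :
    K ≤ L ↔ L.toSubgroup.index ∣ K.toSubgroup.index := by
  constructor
  · intro h
    exact Subgroup.index_dvd_of_le h
  · intro h g hg
    have hg' : Multiplicative.ofAdd (Multiplicative.toAdd g) ∈ K.toSubgroup := by rw [ofAdd_toAdd]; exact hg
    have := (ofAdd_mem_iff_index_dvd K.toSubgroup _).mp hg'
    have hL := (ofAdd_mem_iff_index_dvd L.toSubgroup (Multiplicative.toAdd g)).mpr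
      ((Int.natCast_dvd_natCast.mpr h).trans this)
    rw [ofAdd_toAdd] at hL
    exact hL

/-- There are subgroups of `ℤ` of every positive index.
[cite: Mochizuki2012, I Lem 2.7 (v) p.57] -/
theorem exists_index_eq (n : ℕ) (hn : n ≠ 0) :
    ∃ K : FiniteIndexNormalSubgroup (Multiplicative ℤ), K.toSubgroup.index = n := by
  let H : Subgroup (Multiplicative ℤ) := Subgroup.zpowers (Multiplicative.ofAdd (n : ℤ))
  have hH : H.index = n := by
    rw [index_eq_orderOf]
    refine (orderOf_eq_iff (Nat.pos_of_ne_zero hn)).mpr ⟨?_, fun m hm hm0 h => ?_⟩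
    · rw [← zpow_natCast, ← mk_ofAdd_eq_zpow, QuotientGroup.eq_one_iff]
      exact Subgroup.mem_zpowers _
    · rw [← zpow_natCast, ← mk_ofAdd_eq_zpow, QuotientGroup.eq_one_iff, Subgroup.mem_zpowers_iff] at h
      obtain ⟨k, hk⟩ := h
      rw [← ofAdd_zsmul, smul_eq_mul] at hk
      have hk' : k * (n : ℤ) = (m : ℤ) := Multiplicative.ofAdd.injective hk
      have hdvd : (n : ℤ) ∣ (m : ℤ) := Dvd.intro_left k hk'
      exact absurd (Nat.le_of_dvd hm0 (Int.natCast_dvd_natCast.mp hdvd)) (not_le.mpr hm)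
  haveI : H.FiniteIndex := ⟨by rw [hH]; exact hn⟩
  exact ⟨FiniteIndexNormalSubgroup.ofSubgroup H, hH⟩

/-- **`Ẑ / Ker(Ẑ → ℤ/N) = ℤ/N`, i.e. the kernel of the `N`-th projection consists of `[ℤ:N]`-th powers**: an element of
`Ẑ` with trivial `N`-component is a `[ℤ : N]`-th power in `Ẑ`.
[cite: Mochizuki2012, I Lem 2.7 (v) p.57] -/
theorem exists_pow_index_eq_of_val_eq_one (x : ZHat) (N : FiniteIndexNormalSubgroup (Multiplicative ℤ))
    (hx : x.val N = 1) : ∃ y : ZHat, y ^ N.toSubgroup.index = x := by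
  have hd0 : N.toSubgroup.index ≠ 0 := Subgroup.FiniteIndex.index_ne_zero
  -- for every `M`, a subgroup `K M` of index `[ℤ:N]·[ℤ:M]`
  have hK : ∀ M : FiniteIndexNormalSubgroup (Multiplicative ℤ),
      ∃ K : FiniteIndexNormalSubgroup (Multiplicative ℤ),
        K.toSubgroup.index = N.toSubgroup.index * M.toSubgroup.index := fun M =>
    exists_index_eq _ (mul_ne_zero hd0 Subgroup.FiniteIndex.index_ne_zero)
  choose K hK using hK
  have hKN : ∀ M, K M ≤ N := fun M => (le_iff_index_dvd _ _).mpr ⟨M.toSubgroup.index, hK M⟩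
  have hKM : ∀ M, K M ≤ M := fun M =>
    (le_iff_index_dvd _ _).mpr ⟨N.toSubgroup.index, by rw [hK, Nat.mul_comm]⟩
  have hKmono : ∀ M M' : FiniteIndexNormalSubgroup (Multiplicative ℤ), M ≤ M' → K M ≤ K M' :=
    fun M M' h => (le_iff_index_dvd _ _).mpr (by
      rw [hK, hK]; exact Nat.mul_dvd_mul_left _ (Subgroup.index_dvd_of_le h))
  -- integer representatives of `x` at `K M`, all divisible by `[ℤ:N]`
  have ht : ∀ M, ∃ t : ℤ, x.val (K M) =
      (QuotientGroup.mk (Multiplicative.ofAdd t) : Multiplicative ℤ ⧸ (K M).toSubgroup) :=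
    fun M => exists_val_eq_mk x (K M)
  choose t ht using ht
  have hdt : ∀ M, ((N.toSubgroup.index : ℕ) : ℤ) ∣ t M := by
    intro M
    have h1 : x.val N = (QuotientGroup.mk (Multiplicative.ofAdd (t M)) : Multiplicative ℤ ⧸ N.toSubgroup) :=
      ProfiniteCompletion.val_mk_eq_of_le x (hKN M) _ (ht M)
    rw [hx] at h1
    exact (ofAdd_mem_iff_index_dvd N.toSubgroup (t M)).mp ((QuotientGroup.eq_one_iff _).mp h1.symm)
  choose s hs using hdt
  -- the family `s M (mod M)` is coherent
  obtain ⟨y, hy⟩ := ProfiniteCompletion.exists_val_eq_of_coherent (G := Multiplicative ℤ)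
    (fun M => Multiplicative.ofAdd (s M)) (by
      intro M M' hMM'
      have h1 : x.val (K M') =
          (QuotientGroup.mk (Multiplicative.ofAdd (t M)) : Multiplicative ℤ ⧸ (K M').toSubgroup) :=
        ProfiniteCompletion.val_mk_eq_of_le x (hKmono M M' hMM') _ (ht M)
      have h2 : (QuotientGroup.mk (Multiplicative.ofAdd (t M)) : Multiplicative ℤ ⧸ (K M').toSubgroup) =
          QuotientGroup.mk (Multiplicative.ofAdd (t M')) := h1.symm.trans (ht M')
      rw [QuotientGroup.eq, ← ofAdd_neg, ← ofAdd_add, ofAdd_mem_iff_index_dvd, hK] at h2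
      rw [QuotientGroup.eq, ← ofAdd_neg, ← ofAdd_add, ofAdd_mem_iff_index_dvd]
      rw [hs M, hs M', neg_add_eq_sub, ← mul_sub, Nat.cast_mul] at h2
      rw [neg_add_eq_sub]
      exact Int.dvd_of_mul_dvd_mul_left (Int.natCast_ne_zero.mpr hd0) h2)
  refine ⟨y, Subtype.ext (funext fun M => ?_)⟩
  -- compare the `M`-components through the projection homomorphism
  let π : ZHat →* Multiplicative ℤ ⧸ M.toSubgroup := MonoidHom.mk' (fun z => z.val M) fun _ _ => rfl
  change π (y ^ N.toSubgroup.index) = x.val M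
  rw [map_pow]
  change (y.val M) ^ N.toSubgroup.index = x.val M
  rw [hy M, ProfiniteCompletion.val_mk_eq_of_le x (hKM M) _ (ht M)]
  have e1 : (Multiplicative.ofAdd (s M)) ^ N.toSubgroup.index = Multiplicative.ofAdd (t M) := by
    rw [← ofAdd_nsmul, nsmul_eq_mul, hs M]
  calc (QuotientGroup.mk (Multiplicative.ofAdd (s M)) : Multiplicative ℤ ⧸ M.toSubgroup) ^ N.toSubgroup.index
      = QuotientGroup.mk ((Multiplicative.ofAdd (s M)) ^ N.toSubgroup.index) := (QuotientGroup.mk_pow _ _ _).symm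
    _ = QuotientGroup.mk (Multiplicative.ofAdd (t M)) := by rw [e1]

/-- **Every group endomorphism of `Ẑ` acts on each finite level `ℤ/N` as multiplication by an integer** (namely by
any representative `a` of the `N`-component of the image of `1 ∈ ℤ ⊆ Ẑ`).
[cite: Mochizuki2012, I Lem 2.7 (v) p.57] -/
theorem monoidHom_val_eq (φ : ZHat →* ZHat) (N : FiniteIndexNormalSubgroup (Multiplicative ℤ)) (a : ℤ)
    (ha : (φ (toCompletion (Multiplicative ℤ) (Multiplicative.ofAdd (1 : ℤ)))).val N =
      (QuotientGroup.mk (Multiplicative.ofAdd a) : Multiplicative ℤ ⧸ N.toSubgroup))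
    (x : ZHat) (b : ℤ)
    (hb : x.val N = (QuotientGroup.mk (Multiplicative.ofAdd b) : Multiplicative ℤ ⧸ N.toSubgroup)) :
    (φ x).val N = (QuotientGroup.mk (Multiplicative.ofAdd (b * a)) : Multiplicative ℤ ⧸ N.toSubgroup) := by
  -- `x = y^[ℤ:N] · η(b)` for some `y ∈ Ẑ`
  have hz : (x * (toCompletion (Multiplicative ℤ) (Multiplicative.ofAdd b))⁻¹).val N = 1 := by
    change x.val N * ((toCompletion (Multiplicative ℤ) (Multiplicative.ofAdd b)).val N)⁻¹ = 1
    rw [hb, ProfiniteCompletion.toCompletion_val, mul_inv_cancel]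
  obtain ⟨y, hy⟩ := exists_pow_index_eq_of_val_eq_one _ N hz
  have hx : x = y ^ N.toSubgroup.index * toCompletion (Multiplicative ℤ) (Multiplicative.ofAdd b) := by
    rw [hy, inv_mul_cancel_right]
  have h1 : toCompletion (Multiplicative ℤ) (Multiplicative.ofAdd b) =
      toCompletion (Multiplicative ℤ) (Multiplicative.ofAdd (1 : ℤ)) ^ b := by
    rw [← map_zpow, ← ofAdd_zsmul, smul_eq_mul, mul_one]
  let π : ZHat →* Multiplicative ℤ ⧸ N.toSubgroup := MonoidHom.mk' (fun z => z.val N) fun _ _ => rfl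
  have hπ : π (φ (toCompletion (Multiplicative ℤ) (Multiplicative.ofAdd (1 : ℤ)))) =
      QuotientGroup.mk (Multiplicative.ofAdd a) := ha
  have h2 : π (φ y) ^ N.toSubgroup.index = 1 := by
    obtain ⟨g, hg⟩ := QuotientGroup.mk_surjective (π (φ y))
    rw [← hg, ← QuotientGroup.mk_pow, QuotientGroup.eq_one_iff]
    exact Subgroup.pow_index_mem _ g
  change π (φ x) = _
  rw [hx, map_mul, map_pow, h1, map_zpow, map_mul, map_pow, map_zpow, hπ, h2, one_mul]
  have e2 : (Multiplicative.ofAdd a) ^ b = Multiplicative.ofAdd (b * a) := by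
    rw [← ofAdd_zsmul, zsmul_eq_mul, Int.cast_id]
  calc (QuotientGroup.mk (Multiplicative.ofAdd a) : Multiplicative ℤ ⧸ N.toSubgroup) ^ b
      = QuotientGroup.mk ((Multiplicative.ofAdd a) ^ b) := (QuotientGroup.mk_zpow _ _ _).symm
    _ = QuotientGroup.mk (Multiplicative.ofAdd (b * a)) := by rw [e2]

/-- **`End(Ẑ)` is commutative**: any two group endomorphisms of `Ẑ` commute.
[cite: Mochizuki2012, I Lem 2.7 (v) p.57] -/
theorem monoidHom_comp_comm (φ ψ : ZHat →* ZHat) : φ.comp ψ = ψ.comp φ := by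
  refine MonoidHom.ext fun x => Subtype.ext (funext fun N => ?_)
  obtain ⟨a, ha⟩ := exists_val_eq_mk (φ (toCompletion (Multiplicative ℤ) (Multiplicative.ofAdd (1 : ℤ)))) N
  obtain ⟨b, hb⟩ := exists_val_eq_mk (ψ (toCompletion (Multiplicative ℤ) (Multiplicative.ofAdd (1 : ℤ)))) N
  obtain ⟨c, hc⟩ := exists_val_eq_mk x N
  change (φ (ψ x)).val N = (ψ (φ x)).val N
  rw [monoidHom_val_eq φ N a ha (ψ x) (c * b) (monoidHom_val_eq ψ N b hb x c hc),
    monoidHom_val_eq ψ N b hb (φ x) (c * a) (monoidHom_val_eq φ N a ha x c hc), mul_right_comm]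

/-- Pointwise form: `φ (ψ x) = ψ (φ x)` for all endomorphisms `φ, ψ` of `Ẑ`.
[cite: Mochizuki2012, I Lem 2.7 (v) p.57] -/
theorem monoidHom_apply_comm (φ ψ : ZHat →* ZHat) (x : ZHat) : φ (ψ x) = ψ (φ x) :=
  DFunLike.congr_fun (monoidHom_comp_comm φ ψ) x

/-- **Transport**: in any group isomorphic to `Ẑ`, any two endomorphisms commute.
[cite: Mochizuki2012, I Lem 2.7 (v) p.57] -/
theorem monoidHom_apply_comm_of_mulEquiv {M : Type*} [Group M] (e : M ≃* ZHat) (φ ψ : M →* M) (m : M) :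
    φ (ψ m) = ψ (φ m) := by
  have h := monoidHom_apply_comm (e.toMonoidHom.comp (φ.comp e.symm.toMonoidHom))
    (e.toMonoidHom.comp (ψ.comp e.symm.toMonoidHom)) (e m)
  simp only [MonoidHom.coe_comp, MulEquiv.coe_toMonoidHom, Function.comp_apply,
    MulEquiv.symm_apply_apply] at h
  exact e.injective h

/-- In any group isomorphic to `Ẑ`, any two automorphisms commute (pointwise).
[cite: Mochizuki2012, I Lem 2.7 (v) p.57] -/
theorem mulEquiv_apply_comm_of_mulEquiv {M : Type*} [Group M] (e : M ≃* ZHat) (α β : M ≃* M) (m : M) :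
    α (β m) = β (α m) :=
  monoidHom_apply_comm_of_mulEquiv e α.toMonoidHom β.toMonoidHom m


/-! ### v2 (append-only): the scalar of an endomorphism, and intertwining as an equality of scalars -/

/-- **An endomorphism of `Ẑ` is determined by its value at `1 ∈ ℤ ⊆ Ẑ`** (it acts levelwise as multiplication by
that value). [cite: Mochizuki2012, I Lem 2.7 (v) p.57] -/
theorem monoidHom_eq_of_apply_one_eq (φ ψ : ZHat →* ZHat)
    (h : φ (toCompletion (Multiplicative ℤ) (Multiplicative.ofAdd (1 : ℤ))) =
      ψ (toCompletion (Multiplicative ℤ) (Multiplicative.ofAdd (1 : ℤ)))) : φ = ψ := by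
  refine MonoidHom.ext fun x => Subtype.ext (funext fun N => ?_)
  obtain ⟨a, ha⟩ := exists_val_eq_mk (φ (toCompletion (Multiplicative ℤ) (Multiplicative.ofAdd (1 : ℤ)))) N
  obtain ⟨b, hb⟩ := exists_val_eq_mk x N
  rw [monoidHom_val_eq φ N a ha x b hb, monoidHom_val_eq ψ N a (h ▸ ha) x b hb]

/-- **The SCALAR of an endomorphism of a group `M ≃* Ẑ` does not depend on the identification**: for
`e e' : M ⥲ Ẑ` and `α : M → M`, the profinite integer `e (α (e⁻¹ 1)) ∈ Ẑ` ("the element of `Ẑ` by which `α`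
multiplies", e.g. the value of a cyclotomic character) equals `e' (α (e'⁻¹ 1))` — since `e' e⁻¹ ∈ Aut(Ẑ)` commutes with
`e α e⁻¹`. So every endomorphism of a rank-one free pro-cyclic group has a CANONICAL scalar in `Ẑ`.
[cite: Mochizuki2012, I Lem 2.7 (v) p.57] -/
theorem scalar_indep {M : Type*} [Group M] (e e' : M ≃* ZHat) (α : M →* M) :
    e (α (e.symm (toCompletion (Multiplicative ℤ) (Multiplicative.ofAdd (1 : ℤ))))) =
      e' (α (e'.symm (toCompletion (Multiplicative ℤ) (Multiplicative.ofAdd (1 : ℤ))))) := by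
  have h := monoidHom_apply_comm (e.toMonoidHom.comp (α.comp e.symm.toMonoidHom))
    ((e.symm.trans e').toMonoidHom)
    (e (e'.symm (toCompletion (Multiplicative ℤ) (Multiplicative.ofAdd (1 : ℤ)))))
  simp only [MonoidHom.coe_comp, MulEquiv.coe_toMonoidHom, Function.comp_apply, MulEquiv.trans_apply,
    MulEquiv.symm_apply_apply, MulEquiv.apply_symm_apply] at h
  exact h

/-- **Intertwining ⟺ equal scalars.** For groups `M₁`, `M₂` identified with `Ẑ` by ANY `e₁`, `e₂`, endomorphisms
`s` of `M₁` and `a` of `M₂`, and ANY isomorphism `c : M₁ ⥲ M₂`: `c ∘ s = a ∘ c` iff the scalar of `s` (read through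
`e₁`) equals the scalar of `a` (read through `e₂`). In particular whether SOME / EVERY isomorphism intertwines two
rank-one actions is an identity between two elements of `Ẑ`, each computed on its own side.
[cite: Mochizuki2012, I Lem 2.7 (v) p.57] -/
theorem semiconj_iff_scalar_eq {M₁ M₂ : Type*} [Group M₁] [Group M₂] (e₁ : M₁ ≃* ZHat) (e₂ : M₂ ≃* ZHat)
    (s : M₁ →* M₁) (a : M₂ →* M₂) (c : M₁ ≃* M₂) :
    (∀ ζ, c (s ζ) = a (c ζ)) ↔
      e₁ (s (e₁.symm (toCompletion (Multiplicative ℤ) (Multiplicative.ofAdd (1 : ℤ))))) =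
        e₂ (a (e₂.symm (toCompletion (Multiplicative ℤ) (Multiplicative.ofAdd (1 : ℤ))))) := by
  -- read `s` through `e₂ ∘ c` instead of `e₁`
  rw [scalar_indep e₁ (c.trans e₂) s]
  constructor
  · intro h
    rw [MulEquiv.trans_apply, h]
    simp only [MulEquiv.symm_trans_apply, MulEquiv.apply_symm_apply]
  · intro h ζ
    -- the endomorphisms `(e₂ c) s (e₂ c)⁻¹` and `e₂ a e₂⁻¹` of `Ẑ` agree at `1`, hence everywhere
    have key := monoidHom_eq_of_apply_one_eq
      ((c.trans e₂).toMonoidHom.comp (s.comp (c.trans e₂).symm.toMonoidHom))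
      (e₂.toMonoidHom.comp (a.comp e₂.symm.toMonoidHom)) (by
        simpa only [MonoidHom.coe_comp, MulEquiv.coe_toMonoidHom, Function.comp_apply] using h)
    have := DFunLike.congr_fun key (e₂ (c ζ))
    simp only [MonoidHom.coe_comp, MulEquiv.coe_toMonoidHom, Function.comp_apply, MulEquiv.symm_trans_apply,
      MulEquiv.symm_apply_apply, MulEquiv.trans_apply] at this
    exact e₂.injective this

end ZHat

end Literature.IUT.HodgeTheaters
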